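import Literature.AnabelianGeometry.EtaleTheta.TemperedFrobenioidCor38SubPreStepsAutRigid
import HarnessLib

/-!
# [EtTh] Cor. 3.8 proof row C38-L02a `PreservesPreSteps` (F-2809): along every ω-CHAIN of pre-steps all but
# finitely many images ARE pre-steps; the residual as a kernel DICHOTOMY (cancellative divisor monoids)

S. Mochizuki, *The étale theta function and its Frobenioid-theoretic manifestations*, Publ. RIMS **45** (2009)
[EtTh], Cor. 3.8, proof, PDF p. 81 l. 2–3 ("In particular, by [Mzk17], Theorem 3.4, (ii) … it follows that `Ψ`
preserves pre-steps") [cite: MochizukiEtTh2009, Cor 3.8 p.81]; S. Mochizuki, *The geometry of Frobenioids I*,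
Kyushu J. Math. **62** (2008) [FrdI], §0 pp. 14–18: FSM-morphisms, FSMI-morphisms, categories of FSMFF-type —
"(a) every FSM-morphism that is not an isomorphism factors as a composite of finitely many FSMI-morphisms; (b) for
every object `A` the lengths of composable chains of FSMI-morphisms starting at `A` are bounded"; p. 16 "if `α ∘ β`
is an isomorphism [in a totally epimorphic category], then `α`, `β` are isomorphisms"; Prop. 1.14 (ii)–(iii) p. 36
(the printed route to Thm. 3.4 (ii): pre-steps among FSM-morphisms via BOUNDED FSMI-chains)
[cite: MochizukiFrdI2008, §0 p.17].

abc-iut cell, block C / F (FACT-proving wave), seat abc-iut-f-128 (gen 15).  PROOF-ONLY file (0 definitions), hand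
#10 for the decision on the bare universal closure of `Cor38Hyp.PreservesPreSteps` (FACT-LIST F-2809; label of
record: conditional / instance forms PROVED / bare ∀-closure UNDECIDED as typed).  It sits on top of the kernel
constraints of record for EVERY `h : Cor38Hyp C₁ C₂` — the image of a pre-step is LINEAR (abc-iut-f-151,
`Cor38Hyp.isLinear_map_of_isPreStep`), its base is FIBERWISE-SURJECTIVE (abc-iut-w6-d057,
`Cor38Hyp.isFiberwiseSurjective_baseMap_map_of_isPreStep`) and, for CANCELLATIVE divisor monoids on the source, a
MONOMORPHISM (abc-iut-w6-d079, `Cor38Hyp.isFSM_baseMap_map_of_isPreStep_of_isLinear`), i.e. an FSM arrow of `D₂` —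
and adds what condition (b) of "FSMFF-type" says about SEQUENCES of such arrows.

WHAT IS PROVED (no hypothesis unless named in the signature).
* §1, any category of FSMFF-type ([FrdI] §0): **`IsOfFSMFFType.card_filter_not_isIso_le`** — in an ω-chain
  `X₀ → X₁ → X₂ → ⋯` of FSM arrows at most `N` members are non-invertible, `N` the FSMI-chain bound of (b) at `X₀`
  (the composite `X₀ → X_k` carries an FSMI-chain at least as long as the number of non-invertible members before
  `k`: (a) + concatenation, isomorphisms absorbed); hence **`IsOfFSMFFType.finite_not_isIso_of_chain`**,
  **`IsOfFSMFFType.exists_forall_isIso_of_chain`** (cofinitely many members are isomorphisms).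
* §2, for EVERY record `h : Cor38Hyp C₁ C₂` whose source divisor monoids `Φ₁(A)` are cancellative (every constructed
  record of the cell: free / `ℕ` / `ℚ_{≥0}` / `ℝ_{≥0}`-valued divisors):
  - `Cor38Hyp.isFSM_baseMap_map_of_isPreStep` — `Base(Ψ φ)` is an FSM arrow of `D₂` (the three constraints of record,
    assembled with the degree hypothesis discharged);
  - **`Cor38Hyp.isPreStep_map_or_of_isPreStep`** — THE RESIDUAL AS A DICHOTOMY: either `Ψ φ` IS a pre-step, or
    `Base(Ψ φ)` is a non-invertible FSM arrow of `D₂` admitting an FSMI-factorisation of positive length between two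
    objects of `D₂` that admit NO isomorphism between them (an FSM endomorphism of a category of FSMFF-type is
    invertible, abc-iut-w5-d105's `IsOfFSMFFType.isIso_of_isFSM_of_isEndomorphism`, and `D₂` is totally epimorphic);
  - **`Cor38Hyp.card_filter_not_isPreStep_map_le`**, **`Cor38Hyp.finite_not_isPreStep_map_of_chain`**,
    **`Cor38Hyp.exists_forall_isPreStep_map_of_chain`** — along every ω-chain `P₀ → P₁ → P₂ → ⋯` of composable
    pre-steps of `C₁`, AT MOST `N(Base(Ψ P₀))` of the images `Ψ φ_k` fail to be pre-steps; all but finitely many ARE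
    pre-steps; from some index on, all are (USES `Cor38Hyp.fsmff`: abc-iut-f-032's
    `ConeTwist.preservesPreSteps_shape_false_without_fsmff` moves EVERY member of the chain of translations by its
    cone generator);
  - the `Ψ⁻¹` mirrors (cancellative `Φ₂`).
READING (cell rule R5; the FACT-LIST label of F-2809 is NOT moved by this file).  A separating record with
cancellative divisor monoids must move a pre-step to a linear arrow over a non-invertible FSM arrow `g : A → A'` of
`D₂` between NON-isomorphic objects (`g` a finite composite of FSMI-morphisms, e.g. the arrow of the walking arrow
`[1]`, a step of the tower `(ℕ, ≥)`), and it can do so only SPARSELY: in the tower of translates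
`P → P·Y → P·Y² → ⋯` of the moved pre-step (and in every other ω-chain of pre-steps through it) all but `≤ N` members
keep an invertible base — the failure, if any, is a boundary phenomenon of finitely many "level crossings" per chain,
never a translation-invariant one (contrast: without `fsmff`, abc-iut-f-032's cone record moves every translate).
Desk census of this seat (HOME/staging/f/f-128/g15/F-2809-CENSUS-10-f128g15.md): the model Frobenioid of
`(D, Φ, B)` is the Grothendieck construction `∫_D (A ↦ Model(pt, Φ(A), B(A)))`, `Base` a split fibration; one-object
"swap" designs cannot move a pre-step (degree-one elements of `ℕ_{≥1} ⋉ (Φ ×_{Φ^gp} B)` are mono iff epi, while the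
target base arrow must be epi and non-mono); over `[1]`-type bases the lower fibre is a coreflective cosieve with
counits `π_s`, a structure a point-model fibre cannot reproduce (truncated pasts) — desk only, not kernel.
HONEST FRAMING: bookkeeping about OUR typed Def. 3.6 interface (print's Cor. 3.8 quotes [FrdI] Thm. 3.4 (ii) for
genuine Frobenioids, where Prop. 1.14 (iii) decides pre-steps by bounded FSMI-chains); proved-as-typed ≠
proved-in-print; nothing here bears on [IUTchIII] Cor. 3.12; no side taken; a FACT row is an assumption label;
typed ≠ proved.
-/

namespace Literature.AlgebraicGeometry.Frobenioids

open CategoryTheory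

universe v u

variable {C : Type u} [Category.{v} C]

/-! ## §1 Categories of FSMFF-type: ω-chains of FSM arrows have cofinitely many invertible members -/

/-- Appending an FSM arrow `ψ` to an FSMI-chain of length `m` yields an FSMI-chain of some length `m' ≥ m`, with
`m' ≥ m + 1` when `ψ` is not invertible (condition (a) of "FSMFF-type" factors `ψ`; chains concatenate;
isomorphisms are absorbed). [cite: MochizukiFrdI2008, §0 p.17] -/
theorem IsFSMIChain.exists_comp_of_isFSM (hC : IsOfFSMFFType C) {A B B' : C} {φ : A ⟶ B} {m : ℕ}
    (h : IsFSMIChain φ m) {ψ : B ⟶ B'} (hψ : IsFSM ψ) :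
    ∃ m', m ≤ m' ∧ (¬ IsIso ψ → m + 1 ≤ m') ∧ IsFSMIChain (φ ≫ ψ) m' := by
  by_cases hi : IsIso ψ
  · exact ⟨m, le_rfl, fun h' => (h' hi).elim, by simpa only [asIso_hom] using h.comp_iso (asIso ψ)⟩
  · obtain ⟨n, hn⟩ := hC.factors ψ hψ hi
    exact ⟨n + m, Nat.le_add_left m n, fun _ => by have := hn.pos; omega, h.comp_chain hn⟩

open scoped Classical in
/-- **In a category of FSMFF-type, an ω-chain `X₀ → X₁ → X₂ → ⋯` of FSM arrows has at most `N` non-invertible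
members, `N` any bound for the lengths of FSMI-chains starting at `X₀`** (condition (b)): the composite
`X₀ → X_k` carries an FSMI-chain at least as long as the number of non-invertible members of index `< k`.
[cite: MochizukiFrdI2008, §0 p.18] -/
theorem IsOfFSMFFType.card_filter_not_isIso_le (hC : IsOfFSMFFType C) (X : ℕ → C)
    (f : ∀ k, X k ⟶ X (k + 1)) (hf : ∀ k, IsFSM (f k)) {N : ℕ}
    (hN : ∀ {B : C} (φ : X 0 ⟶ B) (n : ℕ), IsFSMIChain φ n → n ≤ N) (k : ℕ) :
    ((Finset.range k).filter fun i => ¬ IsIso (f i)).card ≤ N := by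
  -- an arrow `X 0 ⟶ X k` with an FSMI-chain at least as long as the number of non-invertible `f i`, `i < k`
  suffices key : ∃ g : X 0 ⟶ X k,
      (((Finset.range k).filter fun i => ¬ IsIso (f i)).card = 0 ∧ IsIso g) ∨
        ∃ m, ((Finset.range k).filter fun i => ¬ IsIso (f i)).card ≤ m ∧ IsFSMIChain g m by
    obtain ⟨g, ⟨h0, -⟩ | ⟨m, hm, hg⟩⟩ := key
    · rw [h0]
      exact Nat.zero_le N
    · exact hm.trans (hN g m hg)
  induction k with
  | zero => exact ⟨𝟙 _, Or.inl ⟨by simp, inferInstance⟩⟩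
  | succ k ih =>
    obtain ⟨g, hg⟩ := ih
    refine ⟨g ≫ f k, ?_⟩
    have hnot : k ∉ (Finset.range k).filter fun i => ¬ IsIso (f i) := by simp
    rw [Finset.range_add_one, Finset.filter_insert]
    by_cases hk : IsIso (f k)
    · rw [if_neg (not_not_intro hk)]
      rcases hg with ⟨h0, hgi⟩ | ⟨m, hm, hgm⟩
      · haveI := hgi
        exact Or.inl ⟨h0, inferInstance⟩
      · exact Or.inr ⟨m, hm, by simpa only [asIso_hom] using hgm.comp_iso (asIso (f k))⟩
    · rw [if_pos hk, Finset.card_insert_of_notMem hnot]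
      obtain ⟨n, hn⟩ := hC.factors (f k) (hf k) hk
      rcases hg with ⟨h0, hgi⟩ | ⟨m, hm, hgm⟩
      · haveI := hgi
        refine Or.inr ⟨n, ?_, by simpa only [asIso_hom] using hn.iso_comp (asIso g)⟩
        rw [h0]
        exact hn.pos
      · exact Or.inr ⟨n + m, by have := hn.pos; omega, hgm.comp_chain hn⟩

/-- **In a category of FSMFF-type only finitely many members of an ω-chain of FSM arrows are non-invertible.**
[cite: MochizukiFrdI2008, §0 p.18] -/
theorem IsOfFSMFFType.finite_not_isIso_of_chain (hC : IsOfFSMFFType C) (X : ℕ → C)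
    (f : ∀ k, X k ⟶ X (k + 1)) (hf : ∀ k, IsFSM (f k)) : {k | ¬ IsIso (f k)}.Finite := by
  classical
  obtain ⟨N, hN⟩ := hC.bounded (X 0)
  by_contra hinf
  obtain ⟨s, hs, hcard⟩ := Set.Infinite.exists_subset_card_eq hinf (N + 1)
  have hsub : s ⊆ (Finset.range (s.sup id + 1)).filter fun i => ¬ IsIso (f i) := by
    intro i hi
    simp only [Finset.mem_filter, Finset.mem_range]
    exact ⟨Nat.lt_succ_of_le (Finset.le_sup (f := id) hi), hs hi⟩
  have := (Finset.card_le_card hsub).trans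
    (hC.card_filter_not_isIso_le X f hf (fun φ n hφ => hN φ n hφ) (s.sup id + 1))
  omega

/-- **In a category of FSMFF-type an ω-chain of FSM arrows consists of isomorphisms from some index on.**
[cite: MochizukiFrdI2008, §0 p.18] -/
theorem IsOfFSMFFType.exists_forall_isIso_of_chain (hC : IsOfFSMFFType C) (X : ℕ → C)
    (f : ∀ k, X k ⟶ X (k + 1)) (hf : ∀ k, IsFSM (f k)) : ∃ K : ℕ, ∀ k, K ≤ k → IsIso (f k) := by
  obtain ⟨K, hK⟩ := (hC.finite_not_isIso_of_chain X f hf).bddAbove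
  refine ⟨K + 1, fun k hk => ?_⟩
  by_contra hki
  have := hK hki
  omega

end Literature.AlgebraicGeometry.Frobenioids

/-! ## §2 The row C38-L02a over the typed Def. 3.6 interface -/

namespace Literature.AnabelianGeometry.EtaleTheta

open CategoryTheory Opposite Literature.AlgebraicGeometry.Frobenioids

universe u₀ v₀ u v w

variable {D₀ : Type u₀} [Category.{v₀} D₀] {V : FrdIMonoidStub.{w}}
  {T : RealifiedDivisorMonoids (D₀ := D₀) V} {D : Type u} [Category.{v} D] {VD : FrdICatStub.{u, v, w} D}

section Rows

variable {D₀' : Type u₀} [Category.{v₀} D₀'] {T' : RealifiedDivisorMonoids (D₀ := D₀') V}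
  {D' : Type u} [Category.{v} D'] {VD' : FrdICatStub.{u, v, w} D'}
  {C₁ : TemperedFrobenioid T D VD} {C₂ : TemperedFrobenioid T' D' VD'}

namespace Cor38Hyp

variable (h : Cor38Hyp C₁ C₂)

/-- **For EVERY record with cancellative source divisor monoids, `Base(Ψ φ)` of a pre-step `φ` is an FSM arrow of
`D₂`** — the three kernel constraints of record assembled: linear (abc-iut-f-151), hence fiberwise-surjective base
(abc-iut-w6-d057) and monic base (abc-iut-w6-d079). [cite: MochizukiEtTh2009, Cor 3.8 p.81] -/
theorem isFSM_baseMap_map_of_isPreStep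
    (hΦ : ∀ (A : Dᵒᵖ) (x y z : C₁.Φ.carrier A), x * y = x * z → y = z)
    {X Y : C₁.category} (φ : X ⟶ Y) (hφ : C₁.opsData.IsPreStep φ) :
    IsFSM (ModelFrobenioid.baseMap (h.Ψ.functor.map φ)) :=
  h.isFSM_baseMap_map_of_isPreStep_of_isLinear hΦ φ hφ (h.isLinear_map_of_isPreStep φ hφ)

/-- The mirror for `Ψ⁻¹` (cancellative divisor monoids on `C₂`): `Base(Ψ⁻¹ φ)` of a pre-step `φ` of `C₂` is an
FSM arrow of `D₁`. [cite: MochizukiEtTh2009, Cor 3.8 p.81] -/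
theorem isFSM_baseMap_inverse_map_of_isPreStep
    (hΦ' : ∀ (A : D'ᵒᵖ) (x y z : C₂.Φ.carrier A), x * y = x * z → y = z)
    {X Y : C₂.category} (φ : X ⟶ Y) (hφ : C₂.opsData.IsPreStep φ) :
    IsFSM (ModelFrobenioid.baseMap (h.Ψ.inverse.map φ)) := by
  have hlin := h.isLinear_inverse_map_of_isPreStep φ hφ
  have hφ' := (C₂.opsData_isPreStep_iff φ).1 hφ
  haveI : IsIso (ModelFrobenioid.baseMap φ) := hφ'.2
  haveI : Mono φ := C₂.mono_of_degFr_eq_one hΦ' φ hφ'.1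
  haveI : Mono (h.Ψ.inverse.map φ) := h.mono_inverse_map_of_mono φ
  exact ⟨h.isFiberwiseSurjective_baseMap_inverse_map_of_isPreStep φ hφ,
    ModelFrobenioid.mono_baseMap_of_mono_of_degFr_eq_one _ hlin⟩

/-- **THE RESIDUAL OF ROW C38-L02a (F-2809) AS A DICHOTOMY, cancellative source divisor monoids, EVERY record**:
for a pre-step `φ : X → Y` of `C₁`, either `Ψ φ` IS a pre-step of `C₂`, or `Base(Ψ φ)` is a NON-invertible FSM arrow
of `D₂` admitting an FSMI-factorisation of positive length ([FrdI] §0 (a)) between two objects `Base(Ψ X)`,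
`Base(Ψ Y)` that admit NO isomorphism between them (an isomorphism would make `Base(Ψ φ)` followed by its inverse an
FSM endomorphism, invertible in a category of FSMFF-type, whence `Base(Ψ φ)` invertible by total epimorphicity).
[cite: MochizukiEtTh2009, Cor 3.8 p.81] -/
theorem isPreStep_map_or_of_isPreStep
    (hΦ : ∀ (A : Dᵒᵖ) (x y z : C₁.Φ.carrier A), x * y = x * z → y = z)
    {X Y : C₁.category} (φ : X ⟶ Y) (hφ : C₁.opsData.IsPreStep φ) :
    C₂.opsData.IsPreStep (h.Ψ.functor.map φ) ∨
      (¬ IsIso (ModelFrobenioid.baseMap (h.Ψ.functor.map φ)) ∧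
        (∃ n, 0 < n ∧ IsFSMIChain (ModelFrobenioid.baseMap (h.Ψ.functor.map φ)) n) ∧
        IsEmpty ((h.Ψ.functor.obj X).base ≅ (h.Ψ.functor.obj Y).base)) := by
  have hlin := h.isLinear_map_of_isPreStep φ hφ
  have hFSM := h.isFSM_baseMap_map_of_isPreStep hΦ φ hφ
  by_cases hi : IsIso (ModelFrobenioid.baseMap (h.Ψ.functor.map φ))
  · exact Or.inl ((C₂.opsData_isPreStep_iff _).2 ⟨hlin, hi⟩)
  · refine Or.inr ⟨hi, ?_, ⟨fun e => hi ?_⟩⟩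
    · obtain ⟨n, hn⟩ := h.fsmff.2.factors _ hFSM hi
      exact ⟨n, hn.pos, hn⟩
    · have hFSM' : IsFSM (ModelFrobenioid.baseMap (h.Ψ.functor.map φ) ≫ e.inv) :=
        hFSM.comp (IsFSM.of_isIso e.inv)
      haveI := h.fsmff.2.isIso_of_isFSM_of_isEndomorphism _ hFSM'
      exact (C₂.isTotallyEpimorphic.isIso_of_isIso_comp (ModelFrobenioid.baseMap (h.Ψ.functor.map φ)) e.inv).2

/-- The mirror dichotomy for `Ψ⁻¹` (cancellative divisor monoids on `C₂`). [cite: MochizukiEtTh2009, Cor 3.8 p.81] -/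
theorem isPreStep_inverse_map_or_of_isPreStep
    (hΦ' : ∀ (A : D'ᵒᵖ) (x y z : C₂.Φ.carrier A), x * y = x * z → y = z)
    {X Y : C₂.category} (φ : X ⟶ Y) (hφ : C₂.opsData.IsPreStep φ) :
    C₁.opsData.IsPreStep (h.Ψ.inverse.map φ) ∨
      (¬ IsIso (ModelFrobenioid.baseMap (h.Ψ.inverse.map φ)) ∧
        (∃ n, 0 < n ∧ IsFSMIChain (ModelFrobenioid.baseMap (h.Ψ.inverse.map φ)) n) ∧
        IsEmpty ((h.Ψ.inverse.obj X).base ≅ (h.Ψ.inverse.obj Y).base)) := by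
  have hlin := h.isLinear_inverse_map_of_isPreStep φ hφ
  have hFSM := h.isFSM_baseMap_inverse_map_of_isPreStep hΦ' φ hφ
  by_cases hi : IsIso (ModelFrobenioid.baseMap (h.Ψ.inverse.map φ))
  · exact Or.inl ((C₁.opsData_isPreStep_iff _).2 ⟨hlin, hi⟩)
  · refine Or.inr ⟨hi, ?_, ⟨fun e => hi ?_⟩⟩
    · obtain ⟨n, hn⟩ := h.fsmff.1.factors _ hFSM hi
      exact ⟨n, hn.pos, hn⟩
    · have hFSM' : IsFSM (ModelFrobenioid.baseMap (h.Ψ.inverse.map φ) ≫ e.inv) :=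
        hFSM.comp (IsFSM.of_isIso e.inv)
      haveI := h.fsmff.1.isIso_of_isFSM_of_isEndomorphism _ hFSM'
      exact (C₁.isTotallyEpimorphic.isIso_of_isIso_comp (ModelFrobenioid.baseMap (h.Ψ.inverse.map φ)) e.inv).2

open scoped Classical in
/-- **Row C38-L02a (F-2809) along ω-CHAINS of pre-steps, quantitative form, EVERY record (cancellative source
divisor monoids)**: for composable pre-steps `φ_k : P_k → P_{k+1}` (`k ∈ ℕ`) of `C₁`, at most `N` of the images
`Ψ φ_k` fail to be pre-steps, `N` any bound for the lengths of FSMI-chains of `D₂` starting at `Base(Ψ P₀)`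
([FrdI] §0 (b) for `D₂`, a clause of `Cor38Hyp.fsmff`). [cite: MochizukiEtTh2009, Cor 3.8 p.81] -/
theorem card_filter_not_isPreStep_map_le
    (hΦ : ∀ (A : Dᵒᵖ) (x y z : C₁.Φ.carrier A), x * y = x * z → y = z)
    (P : ℕ → C₁.category) (φ : ∀ k, P k ⟶ P (k + 1)) (hφ : ∀ k, C₁.opsData.IsPreStep (φ k)) {N : ℕ}
    (hN : ∀ {B : D'} (g : (h.Ψ.functor.obj (P 0)).base ⟶ B) (n : ℕ), IsFSMIChain g n → n ≤ N) (k : ℕ) :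
    ((Finset.range k).filter fun i => ¬ C₂.opsData.IsPreStep (h.Ψ.functor.map (φ i))).card ≤ N := by
  refine le_trans (Finset.card_le_card fun i hi => ?_)
    (h.fsmff.2.card_filter_not_isIso_le (fun k => (h.Ψ.functor.obj (P k)).base)
      (fun k => ModelFrobenioid.baseMap (h.Ψ.functor.map (φ k)))
      (fun k => h.isFSM_baseMap_map_of_isPreStep hΦ _ (hφ k)) hN k)
  simp only [Finset.mem_filter] at hi ⊢
  exact ⟨hi.1, fun hiso => hi.2 ((C₂.opsData_isPreStep_iff _).2 ⟨h.isLinear_map_of_isPreStep _ (hφ i), hiso⟩)⟩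

/-- **Along every ω-chain of composable pre-steps of `C₁`, all but FINITELY many images under `Ψ` are pre-steps of
`C₂`** (every record, cancellative source divisor monoids; uses `Cor38Hyp.fsmff`). [cite: MochizukiEtTh2009, Cor 3.8 p.81] -/
theorem finite_not_isPreStep_map_of_chain
    (hΦ : ∀ (A : Dᵒᵖ) (x y z : C₁.Φ.carrier A), x * y = x * z → y = z)
    (P : ℕ → C₁.category) (φ : ∀ k, P k ⟶ P (k + 1)) (hφ : ∀ k, C₁.opsData.IsPreStep (φ k)) :
    {k | ¬ C₂.opsData.IsPreStep (h.Ψ.functor.map (φ k))}.Finite := by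
  refine (h.fsmff.2.finite_not_isIso_of_chain (fun k => (h.Ψ.functor.obj (P k)).base)
    (fun k => ModelFrobenioid.baseMap (h.Ψ.functor.map (φ k)))
    (fun k => h.isFSM_baseMap_map_of_isPreStep hΦ _ (hφ k))).subset fun k hk hiso => ?_
  exact hk ((C₂.opsData_isPreStep_iff _).2 ⟨h.isLinear_map_of_isPreStep _ (hφ k), hiso⟩)

/-- **Along every ω-chain of composable pre-steps of `C₁`, from some index on EVERY image under `Ψ` is a pre-step
of `C₂`** (every record, cancellative source divisor monoids). [cite: MochizukiEtTh2009, Cor 3.8 p.81] -/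
theorem exists_forall_isPreStep_map_of_chain
    (hΦ : ∀ (A : Dᵒᵖ) (x y z : C₁.Φ.carrier A), x * y = x * z → y = z)
    (P : ℕ → C₁.category) (φ : ∀ k, P k ⟶ P (k + 1)) (hφ : ∀ k, C₁.opsData.IsPreStep (φ k)) :
    ∃ K : ℕ, ∀ k, K ≤ k → C₂.opsData.IsPreStep (h.Ψ.functor.map (φ k)) := by
  obtain ⟨K, hK⟩ := h.fsmff.2.exists_forall_isIso_of_chain (fun k => (h.Ψ.functor.obj (P k)).base)
    (fun k => ModelFrobenioid.baseMap (h.Ψ.functor.map (φ k))) (fun k => h.isFSM_baseMap_map_of_isPreStep hΦ _ (hφ k))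
  exact ⟨K, fun k hk => (C₂.opsData_isPreStep_iff _).2 ⟨h.isLinear_map_of_isPreStep _ (hφ k), hK k hk⟩⟩

/-- The mirror along ω-chains of pre-steps of `C₂` for `Ψ⁻¹` (cancellative divisor monoids on `C₂`): all but finitely
many images are pre-steps of `C₁`. [cite: MochizukiEtTh2009, Cor 3.8 p.81] -/
theorem finite_not_isPreStep_inverse_map_of_chain
    (hΦ' : ∀ (A : D'ᵒᵖ) (x y z : C₂.Φ.carrier A), x * y = x * z → y = z)
    (P : ℕ → C₂.category) (φ : ∀ k, P k ⟶ P (k + 1)) (hφ : ∀ k, C₂.opsData.IsPreStep (φ k)) :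
    {k | ¬ C₁.opsData.IsPreStep (h.Ψ.inverse.map (φ k))}.Finite := by
  refine (h.fsmff.1.finite_not_isIso_of_chain (fun k => (h.Ψ.inverse.obj (P k)).base)
    (fun k => ModelFrobenioid.baseMap (h.Ψ.inverse.map (φ k)))
    (fun k => h.isFSM_baseMap_inverse_map_of_isPreStep hΦ' _ (hφ k))).subset fun k hk hiso => ?_
  exact hk ((C₁.opsData_isPreStep_iff _).2 ⟨h.isLinear_inverse_map_of_isPreStep _ (hφ k), hiso⟩)

/-- The mirror for `Ψ⁻¹`: from some index on every image of an ω-chain of pre-steps of `C₂` is a pre-step of `C₁`.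
[cite: MochizukiEtTh2009, Cor 3.8 p.81] -/
theorem exists_forall_isPreStep_inverse_map_of_chain
    (hΦ' : ∀ (A : D'ᵒᵖ) (x y z : C₂.Φ.carrier A), x * y = x * z → y = z)
    (P : ℕ → C₂.category) (φ : ∀ k, P k ⟶ P (k + 1)) (hφ : ∀ k, C₂.opsData.IsPreStep (φ k)) :
    ∃ K : ℕ, ∀ k, K ≤ k → C₁.opsData.IsPreStep (h.Ψ.inverse.map (φ k)) := by
  obtain ⟨K, hK⟩ := h.fsmff.1.exists_forall_isIso_of_chain (fun k => (h.Ψ.inverse.obj (P k)).base)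
    (fun k => ModelFrobenioid.baseMap (h.Ψ.inverse.map (φ k)))
    (fun k => h.isFSM_baseMap_inverse_map_of_isPreStep hΦ' _ (hφ k))
  exact ⟨K, fun k hk => (C₁.opsData_isPreStep_iff _).2 ⟨h.isLinear_inverse_map_of_isPreStep _ (hφ k), hK k hk⟩⟩

end Cor38Hyp

end Rows

end Literature.AnabelianGeometry.EtaleTheta
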